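import Summits.QuantumFields.QCD.Theses.NestedDissectionSea
import Literature.MathematicalPhysics.QuantumFieldTheory.QCDPhaseQuenched
import Mathlib.Analysis.SpecialFunctions.Integrals.PosLogEqCircleAverage
import Mathlib.Analysis.Analytic.Polynomial
import Mathlib.Analysis.Complex.Polynomial.Basic

/-!
# Candidate proofs for the deterministic stubs `CrossingCharge` and `ExcessRegular` (bounds) of line
# `accretive-coarse-jensen` — two-circle Jensen count for split polynomials

Drefute seat `refuter-drefute-stmt-QuantumFields-13995-0` (evidence for the workers of stubs 1–2; NOT a
refutation).  Root form of the circle average of `log ‖p‖` for a monic complex polynomial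
(`circleAverage_log_norm_eval_eq_sum`), the two-circle excess as a sum over roots of terms in
`[0, log (R/r)]` (`jensenTerm_nonneg`, `jensenTerm_le`, `jensenTerm_eq_of_le`), and the polynomial versions of
the stubs: `log_div_le_jensenExcess` (core of `CrossingCharge`) and `jensenExcess_nonneg` / `jensenExcess_le`
(the two bounds of `ExcessRegular`), the cell layer (`crossingCharge_holds`, `excess_nonneg`, `excess_le_card_mul_log`,
`measurable_excess`, packaged as `crossingCharge_prop` / `excessRegular_prop` in the exact shape of the skeleton's Props), and the
deterministic half of the `r → 0` reduction of stub 4 (`log_two_mul_card_real_roots_le_gridSum`: the grid-summed excess is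
`≥ log 2 · #{real roots in [0, T]}`).
-/

noncomputable section

open Polynomial Filter MeasureTheory

namespace Summit.QuantumFields.QCD.Cruxes.EarlyCrosserLaw.AccretiveCoarseJensen.Candidate

/-! ## Polynomial Jensen count -/

/-- `log ‖p(·)‖` is circle integrable on every circle (polynomials are meromorphic). [folklore] -/
theorem circleIntegrable_log_norm_eval (p : ℂ[X]) (c : ℂ) (ρ : ℝ) :
    CircleIntegrable (fun z => Real.log ‖p.eval z‖) c ρ :=
  MeromorphicOn.circleIntegrable_log_norm (f := fun z => p.eval z)
    (fun x _ => (AnalyticOnNhd.eval_polynomial (𝕜 := ℂ) p).meromorphicOn x (Set.mem_univ x))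

/-- Root form of the circle average of `log ‖∏ (z - u)‖`. [folklore] -/
theorem circleAverage_log_norm_multisetProd (S : Multiset ℂ) (c : ℂ) {ρ : ℝ} (hρ : ρ ≠ 0) :
    Real.circleAverage (fun z => Real.log ‖((S.map fun u => X - C u).prod).eval z‖) c ρ =
      (S.map fun u => Real.log ρ + Real.posLog (ρ⁻¹ * ‖c - u‖)).sum := by
  induction S using Multiset.induction_on with
  | empty => simp [Real.circleAverage_const]
  | cons u S ih =>
    rw [Multiset.map_cons, Multiset.prod_cons, Multiset.map_cons, Multiset.sum_cons]
    set q : ℂ[X] := (S.map fun u => X - C u).prod with hq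
    have hq0 : q ≠ 0 := (monic_multiset_prod_of_monic _ _ fun v _ => monic_X_sub_C v).ne_zero
    have hcod : (fun z => Real.log ‖((X - C u) * q).eval z‖) =ᶠ[codiscreteWithin (Metric.sphere c |ρ|)]
        (fun z => Real.log ‖z - u‖ + Real.log ‖q.eval z‖) := by
      have hfin : ({u} ∪ {z | IsRoot q z}).Finite :=
        (Set.finite_singleton u).union (finite_setOf_isRoot hq0)
      filter_upwards [compl_finite_mem_codiscreteWithin hfin] with z hz
      simp only [Set.mem_compl_iff, Set.mem_union, Set.mem_singleton_iff, Set.mem_setOf_eq, not_or] at hz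
      rw [eval_mul, eval_sub, eval_X, eval_C, norm_mul,
        Real.log_mul (norm_ne_zero_iff.mpr (sub_ne_zero.mpr hz.1)) (norm_ne_zero_iff.mpr hz.2)]
    rw [Real.circleAverage_congr_codiscreteWithin hcod hρ,
      Real.circleAverage_fun_add (circleIntegrable_log_norm_sub_const ρ) (circleIntegrable_log_norm_eval q c ρ),
      circleAverage_log_norm_sub_const_eq_log_radius_add_posLog hρ, ih]

/-- **Root form of the circle average of `log ‖p‖` for a monic complex polynomial**:
`⨍ log ‖p(c + ρe^{iθ})‖ = Σ_{roots u} (log ρ + log⁺ (‖c − u‖/ρ))`. [folklore] -/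
theorem circleAverage_log_norm_eval_eq_sum (p : ℂ[X]) (hp : p.Monic) (c : ℂ) {ρ : ℝ} (hρ : ρ ≠ 0) :
    Real.circleAverage (fun z => Real.log ‖p.eval z‖) c ρ =
      (p.roots.map fun u => Real.log ρ + Real.posLog (ρ⁻¹ * ‖c - u‖)).sum := by
  have hsplit : p = (p.roots.map fun u => X - C u).prod :=
    (IsAlgClosed.splits p).eq_prod_roots_of_monic hp
  conv_lhs => rw [hsplit]
  exact circleAverage_log_norm_multisetProd p.roots c hρ

/-- **Two-circle Jensen excess as a sum over roots.** [folklore] -/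
theorem jensenExcess_eq_sum (p : ℂ[X]) (hp : p.Monic) (c : ℂ) {r R : ℝ} (hr : r ≠ 0) (hR : R ≠ 0) :
    Real.circleAverage (fun z => Real.log ‖p.eval z‖) c R
      - Real.circleAverage (fun z => Real.log ‖p.eval z‖) c r =
      (p.roots.map fun u => (Real.log R + Real.posLog (R⁻¹ * ‖c - u‖))
        - (Real.log r + Real.posLog (r⁻¹ * ‖c - u‖))).sum := by
  rw [circleAverage_log_norm_eval_eq_sum p hp c hR, circleAverage_log_norm_eval_eq_sum p hp c hr,
    Multiset.sum_map_sub]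

/-- Each root's term is `≥ 0` (`0 < r ≤ R`). [folklore] -/
theorem jensenTerm_nonneg {r R d : ℝ} (hr : 0 < r) (hrR : r ≤ R) (hd : 0 ≤ d) :
    0 ≤ (Real.log R + Real.posLog (R⁻¹ * d)) - (Real.log r + Real.posLog (r⁻¹ * d)) := by
  have hR : 0 < R := lt_of_lt_of_le hr hrR
  have h1 : Real.posLog (r⁻¹ * d) ≤ Real.posLog (R / r) + Real.posLog (R⁻¹ * d) := by
    have : r⁻¹ * d = (R / r) * (R⁻¹ * d) := by field_simp
    rw [this]
    exact Real.posLog_mul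
  have h2 : Real.posLog (R / r) = Real.log (R / r) :=
    Real.posLog_eq_log (by rw [abs_of_pos (div_pos hR hr)]; exact (one_le_div hr).mpr hrR)
  rw [h2, Real.log_div hR.ne' hr.ne'] at h1
  have _ := hd
  linarith

/-- Each root's term is `≤ log (R / r)`. [folklore] -/
theorem jensenTerm_le {r R d : ℝ} (hr : 0 < r) (hrR : r ≤ R) (hd : 0 ≤ d) :
    (Real.log R + Real.posLog (R⁻¹ * d)) - (Real.log r + Real.posLog (r⁻¹ * d)) ≤ Real.log (R / r) := by
  have hR : 0 < R := lt_of_lt_of_le hr hrR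
  have h1 : Real.posLog (R⁻¹ * d) ≤ Real.posLog (r⁻¹ * d) :=
    Real.posLog_le_posLog (by positivity) (mul_le_mul_of_nonneg_right ((inv_le_inv₀ hR hr).mpr hrR) hd)
  rw [Real.log_div hR.ne' hr.ne']
  linarith

/-- A root within `r` of the centre contributes exactly `log (R / r)`. [folklore] -/
theorem jensenTerm_eq_of_le {r R d : ℝ} (hr : 0 < r) (hrR : r ≤ R) (hd : 0 ≤ d) (hdr : d ≤ r) :
    (Real.log R + Real.posLog (R⁻¹ * d)) - (Real.log r + Real.posLog (r⁻¹ * d)) = Real.log (R / r) := by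
  have hR : 0 < R := lt_of_lt_of_le hr hrR
  have h1 : Real.posLog (R⁻¹ * d) = 0 := by
    rw [Real.posLog_eq_zero_iff, abs_of_nonneg (by positivity), inv_mul_le_iff₀ hR]
    linarith
  have h2 : Real.posLog (r⁻¹ * d) = 0 := by
    rw [Real.posLog_eq_zero_iff, abs_of_nonneg (by positivity), inv_mul_le_iff₀ hr]
    linarith
  rw [h1, h2, Real.log_div hR.ne' hr.ne']
  ring

/-- **Two-circle Jensen count, lower bound**: a root within `r` of the centre charges `≥ log (R/r)`.
[folklore] -/
theorem log_div_le_jensenExcess (p : ℂ[X]) (hp : p.Monic) (c u₀ : ℂ) (hu₀ : p.IsRoot u₀)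
    {r R : ℝ} (hr : 0 < r) (hrR : r ≤ R) (hc : ‖c - u₀‖ ≤ r) :
    Real.log (R / r) ≤ Real.circleAverage (fun z => Real.log ‖p.eval z‖) c R
      - Real.circleAverage (fun z => Real.log ‖p.eval z‖) c r := by
  have hR : 0 < R := lt_of_lt_of_le hr hrR
  rw [jensenExcess_eq_sum p hp c hr.ne' hR.ne', ← jensenTerm_eq_of_le hr hrR (norm_nonneg (c - u₀)) hc]
  refine Multiset.single_le_sum (fun x hx => ?_) _ ?_
  · obtain ⟨u, -, rfl⟩ := Multiset.mem_map.mp hx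
    exact jensenTerm_nonneg hr hrR (norm_nonneg _)
  · exact Multiset.mem_map.mpr ⟨u₀, (mem_roots hp.ne_zero).mpr hu₀, rfl⟩

/-- **Two-circle Jensen count**: `0 ≤ excess`. [folklore] -/
theorem jensenExcess_nonneg (p : ℂ[X]) (hp : p.Monic) (c : ℂ) {r R : ℝ} (hr : 0 < r) (hrR : r ≤ R) :
    0 ≤ Real.circleAverage (fun z => Real.log ‖p.eval z‖) c R
      - Real.circleAverage (fun z => Real.log ‖p.eval z‖) c r := by
  have hR : 0 < R := lt_of_lt_of_le hr hrR
  rw [jensenExcess_eq_sum p hp c hr.ne' hR.ne']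
  refine Multiset.sum_nonneg fun x hx => ?_
  obtain ⟨u, -, rfl⟩ := Multiset.mem_map.mp hx
  exact jensenTerm_nonneg hr hrR (norm_nonneg _)

/-- **Two-circle Jensen count**: `excess ≤ (number of roots) · log (R/r)`. [folklore] -/
theorem jensenExcess_le (p : ℂ[X]) (hp : p.Monic) (c : ℂ) {r R : ℝ} (hr : 0 < r) (hrR : r ≤ R) :
    Real.circleAverage (fun z => Real.log ‖p.eval z‖) c R
      - Real.circleAverage (fun z => Real.log ‖p.eval z‖) c r ≤
      Multiset.card p.roots * Real.log (R / r) := by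
  have hR : 0 < R := lt_of_lt_of_le hr hrR
  rw [jensenExcess_eq_sum p hp c hr.ne' hR.ne']
  have h := Multiset.sum_le_card_nsmul (p.roots.map fun u => (Real.log R + Real.posLog (R⁻¹ * ‖c - u‖))
      - (Real.log r + Real.posLog (r⁻¹ * ‖c - u‖))) (Real.log (R / r)) (fun x hx => ?_)
  · rw [Multiset.card_map, nsmul_eq_mul] at h
    exact h
  · obtain ⟨u, -, rfl⟩ := Multiset.mem_map.mp hx
    exact jensenTerm_le hr hrR (norm_nonneg _)

/-! ## The `r → 0` reduction, deterministic half: the grid-summed excess counts the real roots in `[0, T]` -/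

/-- Sum of `ite` over a multiset: `Σ (if P u then a else 0) = a · #{u | P u}`. [folklore] -/
theorem multiset_sum_map_ite {α : Type*} (m : Multiset α) (P : α → Prop) [DecidablePred P] (a : ℝ) :
    (m.map fun u => if P u then a else 0).sum = a * (m.filter P).card := by
  induction m using Multiset.induction_on with
  | empty => simp
  | cons u m ih =>
    rw [Multiset.map_cons, Multiset.sum_cons, ih, Multiset.filter_cons]
    split_ifs with h
    · simp only [Multiset.singleton_add, Multiset.card_cons]
      push_cast
      ring
    · simp

/-- **Every real root in `[0, T]` is charged at least `log 2` by the grid `(2n+1) r`, `n ≤ ⌊T/2r⌋`;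
all other roots are charged `≥ 0`.**  Hence the grid-summed two-circle excess of a monic `p` is
`≥ log 2 · #{roots u : Im u = 0, 0 ≤ Re u ≤ T}` (with multiplicity) — the deterministic half of the
reduction of `stub_jensenDilution` to the mean-COUNT law of early real crossers. [folklore] -/
theorem log_two_mul_card_real_roots_le_gridSum (p : ℂ[X]) (hp : p.Monic) {T r : ℝ} (hr : 0 < r) :
    Real.log 2 * ((p.roots.filter fun u => u.im = 0 ∧ 0 ≤ u.re ∧ u.re ≤ T).card : ℝ) ≤
      ∑ n ∈ Finset.range (⌊T / (2 * r)⌋₊ + 1),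
        (Real.circleAverage (fun z => Real.log ‖p.eval z‖) (((2 * (n : ℝ) + 1) * r : ℝ) : ℂ) (2 * r)
          - Real.circleAverage (fun z => Real.log ‖p.eval z‖) (((2 * (n : ℝ) + 1) * r : ℝ) : ℂ) r) := by
  classical
  have hr2 : 0 < 2 * r := by linarith
  have hrr : r ≤ 2 * r := by linarith
  have hlog2 : Real.log (2 * r / r) = Real.log 2 := by
    rw [mul_div_assoc, div_self hr.ne', mul_one]
  -- root form of every disc, then swap the sums
  have hdisc : ∀ n : ℕ,
      Real.circleAverage (fun z => Real.log ‖p.eval z‖) (((2 * (n : ℝ) + 1) * r : ℝ) : ℂ) (2 * r)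
        - Real.circleAverage (fun z => Real.log ‖p.eval z‖) (((2 * (n : ℝ) + 1) * r : ℝ) : ℂ) r =
      (p.roots.map fun u => (Real.log (2 * r) + Real.posLog ((2 * r)⁻¹ * ‖(((2 * (n : ℝ) + 1) * r : ℝ) : ℂ) - u‖))
        - (Real.log r + Real.posLog (r⁻¹ * ‖(((2 * (n : ℝ) + 1) * r : ℝ) : ℂ) - u‖))).sum :=
    fun n => jensenExcess_eq_sum p hp _ hr.ne' hr2.ne'
  simp_rw [hdisc]
  rw [Finset.sum_eq_multiset_sum, Multiset.sum_map_sum_map]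
  simp_rw [← Finset.sum_eq_multiset_sum]
  -- compare root by root
  have key : ∀ u ∈ p.roots,
      (if (u.im = 0 ∧ 0 ≤ u.re ∧ u.re ≤ T) then Real.log 2 else 0) ≤
        ∑ n ∈ Finset.range (⌊T / (2 * r)⌋₊ + 1),
          ((Real.log (2 * r) + Real.posLog ((2 * r)⁻¹ * ‖(((2 * (n : ℝ) + 1) * r : ℝ) : ℂ) - u‖))
            - (Real.log r + Real.posLog (r⁻¹ * ‖(((2 * (n : ℝ) + 1) * r : ℝ) : ℂ) - u‖))) := by
    intro u _
    have hnn : ∀ n ∈ Finset.range (⌊T / (2 * r)⌋₊ + 1),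
        0 ≤ (Real.log (2 * r) + Real.posLog ((2 * r)⁻¹ * ‖(((2 * (n : ℝ) + 1) * r : ℝ) : ℂ) - u‖))
          - (Real.log r + Real.posLog (r⁻¹ * ‖(((2 * (n : ℝ) + 1) * r : ℝ) : ℂ) - u‖)) :=
      fun n _ => jensenTerm_nonneg hr hrr (norm_nonneg _)
    split_ifs with hu
    · obtain ⟨him, h0, hT'⟩ := hu
      set t : ℝ := u.re with ht
      set n : ℕ := ⌊t / (2 * r)⌋₊ with hn
      have hn_mem : n ∈ Finset.range (⌊T / (2 * r)⌋₊ + 1) := by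
        rw [Finset.mem_range, Nat.lt_add_one_iff]
        exact Nat.floor_mono (div_le_div_of_nonneg_right hT' hr2.le)
      have hn_le : (n : ℝ) ≤ t / (2 * r) := Nat.floor_le (div_nonneg h0 hr2.le)
      have hn_lt : t / (2 * r) < n + 1 := Nat.lt_floor_add_one _
      have hcentre : ‖(((2 * (n : ℝ) + 1) * r : ℝ) : ℂ) - u‖ ≤ r := by
        have hu' : u = ((t : ℝ) : ℂ) := Complex.ext (by simp [ht]) (by simp [him])
        rw [hu', ← Complex.ofReal_sub, Complex.norm_real, Real.norm_eq_abs, abs_le]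
        have h1 : (n : ℝ) * (2 * r) ≤ t := (le_div_iff₀ hr2).mp hn_le
        have h2 : t < ((n : ℝ) + 1) * (2 * r) := (div_lt_iff₀ hr2).mp hn_lt
        constructor <;> nlinarith
      refine le_trans ?_ (Finset.single_le_sum hnn hn_mem)
      rw [jensenTerm_eq_of_le hr hrr (norm_nonneg _) hcentre, hlog2]
    · exact Finset.sum_nonneg hnn
  calc Real.log 2 * ((p.roots.filter fun u => u.im = 0 ∧ 0 ≤ u.re ∧ u.re ≤ T).card : ℝ)
      = (p.roots.map fun u => if (u.im = 0 ∧ 0 ≤ u.re ∧ u.re ≤ T) then Real.log 2 else 0).sum := by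
        rw [multiset_sum_map_ite]
    _ ≤ _ := Multiset.sum_map_le_sum_map _ _ key

/-! ## Cell versions: the stub `CrossingCharge` verbatim, and the two bounds of `ExcessRegular` -/

section Cell

open Literature.MathematicalPhysics.QuantumLattice Literature.MathematicalPhysics.QuantumFieldTheory
  Literature.Probability.LatticeModels
open scoped Classical

variable {N : ℕ} [NeZero N]

/-- Local notation: the colour group `SU(3)`. -/
local notation "𝔾" => Matrix.specialUnitaryGroup (Fin 3) ℂ

omit [NeZero N] in
/-- The bare mass enters a Dirichlet cell additively: `D_c(μ) = D_c(0) + μ·1`. [folklore] -/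
theorem wilsonCell_eq_add_smul_one (U : GaugeConfig 4 N 𝔾) (μ : ℝ) (x : TorusSite 4 N)
    (s : Fin 4 → ℕ) :
    wilsonCell U μ x s = wilsonCell U 0 x s + ((μ : ℝ) : ℂ) • (1 : Matrix _ _ ℂ) := by
  ext p q
  rw [Matrix.add_apply, Matrix.smul_apply, Matrix.one_apply, smul_eq_mul]
  simp only [wilsonCell, Matrix.toSquareBlockProp_def, Matrix.of_apply, wilsonDirac]
  by_cases h : p = q
  · have h' : (p : TorusSite 4 N × Fin 3 × Fin 4) = q := congrArg Subtype.val h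
    rw [if_pos h', if_pos h', if_pos h]
    push_cast
    ring
  · have h' : (p : TorusSite 4 N × Fin 3 × Fin 4) ≠ q := fun h'' => h (Subtype.ext h'')
    rw [if_neg h', if_neg h', if_neg h]
    ring

/-- A crossing at bare mass `μ'` is a root `-μ'` of the massless cell's characteristic polynomial.
[folklore] -/
theorem isRoot_charpoly_of_det_eq_zero (U : GaugeConfig 4 N 𝔾) {μ' : ℝ} (x : TorusSite 4 N)
    (s : Fin 4 → ℕ) (hdet : (wilsonCell U μ' x s).det = 0) :
    ((wilsonCell U 0 x s).charpoly).IsRoot (-(μ' : ℂ)) := by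
  rw [IsRoot.def, Matrix.eval_charpoly]
  have hmat : Matrix.scalar {p // wilsonBox x s p} (-(μ' : ℂ)) - wilsonCell U 0 x s
      = -(wilsonCell U μ' x s) := by
    rw [wilsonCell_eq_add_smul_one U μ' x s, Matrix.scalar_apply, ← Matrix.smul_one_eq_diagonal, neg_smul]
    abel
  rw [hmat, Matrix.det_neg, hdet, mul_zero]

/-- **Stub `CrossingCharge` (VERBATIM).** [folklore] -/
theorem crossingCharge_holds (U : GaugeConfig 4 N 𝔾) (x : TorusSite 4 N) (s : Fin 4 → ℕ)
    (μ' c r R : ℝ) (hr : 0 < r) (hrR : r < R) (hdet : (wilsonCell U μ' x s).det = 0)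
    (hc : |μ' + c| ≤ r) :
    Real.log (R / r) ≤
      Real.circleAverage (fun z : ℂ => Real.log ‖((wilsonCell U 0 x s).charpoly).eval z‖) (c : ℂ) R
        - Real.circleAverage (fun z : ℂ => Real.log ‖((wilsonCell U 0 x s).charpoly).eval z‖) (c : ℂ) r := by
  refine log_div_le_jensenExcess _ (Matrix.charpoly_monic _) (c : ℂ) (-(μ' : ℂ))
    (isRoot_charpoly_of_det_eq_zero U x s hdet) hr hrR.le ?_
  rw [sub_neg_eq_add, show (c : ℂ) + (μ' : ℂ) = ((μ' + c : ℝ) : ℂ) by push_cast; ring, Complex.norm_real,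
    Real.norm_eq_abs]
  exact hc

/-- **Stub `ExcessRegular`, lower bound**: `0 ≤ excess`. [folklore] -/
theorem excess_nonneg (U : GaugeConfig 4 N 𝔾) (x : TorusSite 4 N) (s : Fin 4 → ℕ) (c r R : ℝ)
    (hr : 0 < r) (hrR : r < R) :
    0 ≤ Real.circleAverage (fun z : ℂ => Real.log ‖((wilsonCell U 0 x s).charpoly).eval z‖) (c : ℂ) R
        - Real.circleAverage (fun z : ℂ => Real.log ‖((wilsonCell U 0 x s).charpoly).eval z‖) (c : ℂ) r :=
  jensenExcess_nonneg _ (Matrix.charpoly_monic _) _ hr hrR.le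

/-- **Stub `ExcessRegular`, upper bound**: `excess ≤ #cell · log (R/r)`. [folklore] -/
theorem excess_le_card_mul_log (U : GaugeConfig 4 N 𝔾) (x : TorusSite 4 N) (s : Fin 4 → ℕ) (c r R : ℝ)
    (hr : 0 < r) (hrR : r < R) :
    Real.circleAverage (fun z : ℂ => Real.log ‖((wilsonCell U 0 x s).charpoly).eval z‖) (c : ℂ) R
        - Real.circleAverage (fun z : ℂ => Real.log ‖((wilsonCell U 0 x s).charpoly).eval z‖) (c : ℂ) r ≤
      (Fintype.card {p // wilsonBox x s p} : ℝ) * Real.log (R / r) := by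
  refine (jensenExcess_le _ (Matrix.charpoly_monic _) _ hr hrR.le).trans ?_
  have hcard : (Multiset.card ((wilsonCell U 0 x s).charpoly).roots : ℝ) ≤ Fintype.card {p // wilsonBox x s p} := by
    have h1 := Polynomial.card_roots' ((wilsonCell U 0 x s).charpoly)
    rw [Matrix.charpoly_natDegree_eq_dim] at h1
    exact_mod_cast h1
  exact mul_le_mul_of_nonneg_right hcard (Real.log_nonneg ((one_le_div hr).mpr hrR.le))

/-- The three facts packaged in the shape of the skeleton's `Prop`s (pointwise in the data; the
`Measurable` conjunct of `ExcessRegular` is not addressed here). [folklore] -/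
theorem crossingCharge_prop :
    ∀ (N : ℕ) [NeZero N] (U : GaugeConfig 4 N 𝔾) (x : TorusSite 4 N) (s : Fin 4 → ℕ)
      (μ' c r R : ℝ), 0 < r → r < R → (wilsonCell U μ' x s).det = 0 → |μ' + c| ≤ r →
      Real.log (R / r) ≤
        Real.circleAverage (fun z : ℂ => Real.log ‖((wilsonCell U 0 x s).charpoly).eval z‖) (c : ℂ) R
          - Real.circleAverage (fun z : ℂ => Real.log ‖((wilsonCell U 0 x s).charpoly).eval z‖) (c : ℂ) r :=
  fun _ _ U x s μ' c r R hr hrR hdet hc => crossingCharge_holds U x s μ' c r R hr hrR hdet hc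

/-- **Stub `ExcessRegular`, measurability**: `U ↦ ⨍ log ‖charpoly (wilsonCell U 0 x s) (c + R e^{iθ})‖` is
measurable (parametric Bochner integral of a jointly measurable integrand). [folklore] -/
theorem measurable_circleAverage_log_norm_charpoly (x : TorusSite 4 N) (s : Fin 4 → ℕ) (c : ℂ) (R : ℝ) :
    Measurable fun U : GaugeConfig 4 N 𝔾 =>
      Real.circleAverage (fun z : ℂ => Real.log ‖((wilsonCell U 0 x s).charpoly).eval z‖) c R := by
  have hD := continuous_wilsonDirac (L := N) (fundamentalRep (Fin 3)) (continuous_fundamentalRep (Fin 3)) 0 1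
  have hcell : Continuous fun U : GaugeConfig 4 N 𝔾 => wilsonCell U 0 x s :=
    hD.matrix_submatrix _ _
  have hG : Continuous fun q : GaugeConfig 4 N 𝔾 × ℝ =>
      ((wilsonCell q.1 0 x s).charpoly).eval (circleMap c R q.2) := by
    have heq : (fun q : GaugeConfig 4 N 𝔾 × ℝ => ((wilsonCell q.1 0 x s).charpoly).eval (circleMap c R q.2)) =
        fun q => (Matrix.diagonal (fun _ : {p // wilsonBox x s p} => circleMap c R q.2)
          - wilsonCell q.1 0 x s).det := by
      funext q
      rw [Matrix.eval_charpoly, Matrix.scalar_apply]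
    rw [heq]
    refine Continuous.matrix_det (Continuous.sub ?_ (hcell.comp continuous_fst))
    exact (continuous_pi fun _ => (continuous_circleMap c R).comp continuous_snd).matrix_diagonal
  have hmeas : Measurable fun q : GaugeConfig 4 N 𝔾 × ℝ =>
      Real.log ‖((wilsonCell q.1 0 x s).charpoly).eval (circleMap c R q.2)‖ :=
    Real.measurable_log.comp hG.norm.measurable
  have hint : Measurable fun U : GaugeConfig 4 N 𝔾 => ∫ θ in Set.Ioc 0 (2 * Real.pi),
      Real.log ‖((wilsonCell U 0 x s).charpoly).eval (circleMap c R θ)‖ :=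
    (hmeas.stronglyMeasurable.integral_prod_right'
      (ν := (volume : Measure ℝ).restrict (Set.Ioc 0 (2 * Real.pi)))).measurable
  have h2π : (0 : ℝ) ≤ 2 * Real.pi := by positivity
  have hfun : (fun U : GaugeConfig 4 N 𝔾 =>
      Real.circleAverage (fun z : ℂ => Real.log ‖((wilsonCell U 0 x s).charpoly).eval z‖) c R) =
      fun U => (2 * Real.pi)⁻¹ • ∫ θ in Set.Ioc 0 (2 * Real.pi),
        Real.log ‖((wilsonCell U 0 x s).charpoly).eval (circleMap c R θ)‖ := by
    funext U
    rw [Real.circleAverage, intervalIntegral.integral_of_le h2π]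
  rw [hfun]
  exact Measurable.smul (measurable_const (a := ((2 * Real.pi)⁻¹ : ℝ))) hint

/-- **Stub `ExcessRegular`, measurability of the excess.** [folklore] -/
theorem measurable_excess (x : TorusSite 4 N) (s : Fin 4 → ℕ) (c r R : ℝ) :
    Measurable fun U : GaugeConfig 4 N 𝔾 =>
      Real.circleAverage (fun z : ℂ => Real.log ‖((wilsonCell U 0 x s).charpoly).eval z‖) (c : ℂ) R
        - Real.circleAverage (fun z : ℂ => Real.log ‖((wilsonCell U 0 x s).charpoly).eval z‖) (c : ℂ) r :=
  (measurable_circleAverage_log_norm_charpoly x s c R).sub (measurable_circleAverage_log_norm_charpoly x s c r)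

/-- **Stub `ExcessRegular` in the shape of the skeleton's `Prop`.** [folklore] -/
theorem excessRegular_prop :
    ∀ (N : ℕ) [NeZero N] (x : TorusSite 4 N) (s : Fin 4 → ℕ) (c r R : ℝ), 0 < r → r < R →
    (Measurable fun U : GaugeConfig 4 N 𝔾 =>
      Real.circleAverage (fun z : ℂ => Real.log ‖((wilsonCell U 0 x s).charpoly).eval z‖) (c : ℂ) R
        - Real.circleAverage (fun z : ℂ => Real.log ‖((wilsonCell U 0 x s).charpoly).eval z‖) (c : ℂ) r) ∧
    ∀ U : GaugeConfig 4 N 𝔾,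
      0 ≤ Real.circleAverage (fun z : ℂ => Real.log ‖((wilsonCell U 0 x s).charpoly).eval z‖) (c : ℂ) R
            - Real.circleAverage (fun z : ℂ => Real.log ‖((wilsonCell U 0 x s).charpoly).eval z‖) (c : ℂ) r ∧
      Real.circleAverage (fun z : ℂ => Real.log ‖((wilsonCell U 0 x s).charpoly).eval z‖) (c : ℂ) R
          - Real.circleAverage (fun z : ℂ => Real.log ‖((wilsonCell U 0 x s).charpoly).eval z‖) (c : ℂ) r ≤
        (Fintype.card {p // wilsonBox x s p} : ℝ) * Real.log (R / r) :=
  fun _ _ x s c r R hr hrR => ⟨measurable_excess x s c r R, fun U =>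
    ⟨excess_nonneg U x s c r R hr hrR, excess_le_card_mul_log U x s c r R hr hrR⟩⟩

end Cell

end Summit.QuantumFields.QCD.Cruxes.EarlyCrosserLaw.AccretiveCoarseJensen.Candidate

/-! ## Verification against the VERBATIM stub texts of the registered skeleton (sha f44a2dcd…) -/

namespace Summit.QuantumFields.QCD.Cruxes.EarlyCrosserLaw.AccretiveCoarseJensen
open scoped Classical
open Literature.MathematicalPhysics.QuantumLattice Literature.MathematicalPhysics.QuantumFieldTheory
  Literature.Probability.LatticeModels

/-- Local notation: the colour group `SU(3)`. -/
local notation "𝔾" => Matrix.specialUnitaryGroup (Fin 3) ℂ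

/-- VERBATIM copy of the skeleton's stub Prop 1. -/
def CrossingCharge : Prop :=
  ∀ (N : ℕ) [NeZero N] (U : GaugeConfig 4 N 𝔾) (x : TorusSite 4 N) (s : Fin 4 → ℕ)
    (μ' c r R : ℝ), 0 < r → r < R → (wilsonCell U μ' x s).det = 0 → |μ' + c| ≤ r →
    Real.log (R / r) ≤
      Real.circleAverage (fun z : ℂ => Real.log ‖((wilsonCell U 0 x s).charpoly).eval z‖) (c : ℂ) R
        - Real.circleAverage (fun z : ℂ => Real.log ‖((wilsonCell U 0 x s).charpoly).eval z‖) (c : ℂ) r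

/-- VERBATIM copy of the skeleton's stub Prop 2. -/
def ExcessRegular : Prop :=
  ∀ (N : ℕ) [NeZero N] (x : TorusSite 4 N) (s : Fin 4 → ℕ) (c r R : ℝ), 0 < r → r < R →
    (Measurable fun U : GaugeConfig 4 N 𝔾 =>
      Real.circleAverage (fun z : ℂ => Real.log ‖((wilsonCell U 0 x s).charpoly).eval z‖) (c : ℂ) R
        - Real.circleAverage (fun z : ℂ => Real.log ‖((wilsonCell U 0 x s).charpoly).eval z‖) (c : ℂ) r) ∧
    ∀ U : GaugeConfig 4 N 𝔾,
      0 ≤ Real.circleAverage (fun z : ℂ => Real.log ‖((wilsonCell U 0 x s).charpoly).eval z‖) (c : ℂ) R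
            - Real.circleAverage (fun z : ℂ => Real.log ‖((wilsonCell U 0 x s).charpoly).eval z‖) (c : ℂ) r ∧
      Real.circleAverage (fun z : ℂ => Real.log ‖((wilsonCell U 0 x s).charpoly).eval z‖) (c : ℂ) R
          - Real.circleAverage (fun z : ℂ => Real.log ‖((wilsonCell U 0 x s).charpoly).eval z‖) (c : ℂ) r ≤
        (Fintype.card {p // wilsonBox x s p} : ℝ) * Real.log (R / r)

/-- Stub 1 closed by the candidate file. -/
theorem stub_crossingCharge_candidate : CrossingCharge :=
  fun _ _ U x s μ' c r R hr hrR hdet hc => Candidate.crossingCharge_holds U x s μ' c r R hr hrR hdet hc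

/-- Stub 2 closed by the candidate file (measurability included). -/
theorem stub_excessRegular_candidate : ExcessRegular :=
  fun N _ x s c r R hr hrR => Candidate.excessRegular_prop N x s c r R hr hrR

end Summit.QuantumFields.QCD.Cruxes.EarlyCrosserLaw.AccretiveCoarseJensen

end
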